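import Literature.Analysis.PDE.LoewnerNirenbergLargeSolution
import Literature.Analysis.PDE.LoewnerNirenbergFactsProofs
import Literature.Analysis.PDE.LoewnerNirenbergKelvin
import HarnessLib

/-!
# The maximal solution of a half-space, and the Möbius covariance of `u_Ω` — unconditionally

Two consequences of the maximal-solution fact
`Literature.Analysis.PDE.LoewnerNirenberg.exists_isMaximalSolution` (F1 of
`LoewnerNirenbergFacts.lean`) that the Facts file derives FROM F1 — `loewnerNirenberg_halfSpace`
(LN4 on a half-space, from F1 and F5) and `loewnerNirenberg_inversion` (LN2, from F1 and F4) —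
PROVED here with no named fact, from the now unconditional bound "every solution lies below
`u_Ω`" (`IsSolution.le_loewnerNirenberg_of_isOpen`, `LoewnerNirenbergMaximal.lean`;
González–Li–Nguyen 2018, Lemma 3.1) together with the discharged F4
(`isSolution_kelvinTransform_holds`, `LoewnerNirenbergKelvin.lean`) and the half-space profile
(`isSolution_halfSpaceProfile`, `LoewnerNirenbergFactsProofs.lean`), `n ≥ 3`:

* **F1 for half-spaces, proved** — `IsSolution.le_halfSpaceProfile`: every solution `v` on
  `H = H(p,ν)`, `‖ν‖ = 1`, satisfies `v(x) ≤ ⟪x-p,ν⟫^{-(n-2)/2} = dist(x,∂H)^{-(n-2)/2}`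
  (comparison with the solutions of the balls `B(x + (R-d)ν, R) ⊆ H` tangent to `∂H` from
  inside, `d = ⟪x-p,ν⟫`, whose value at `x` is `(2R/(d(2R-d)))^{(n-2)/2} → d^{-(n-2)/2}` as
  `R → ∞` — the device of Loewner–Nirenberg, González–Li–Nguyen 2018, proof of Lemma 3.4, and of
  Duncan–Nguyen 2025, Cor. 1.4 as formalised in `IsLargeSolution.eqOn_halfSpaceProfile`); hence
  the profile is the MAXIMAL solution of `H` (`isMaximalSolution_halfSpaceProfile`,
  `exists_isMaximalSolution_halfSpace`) and **LN4 (half-space)** holds with no hypothesis: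
  `u_H = dist(·,∂H)^{-(n-2)/2}` on `H` (`loewnerNirenberg_halfSpace_eqOn`).
* **LN2 — Möbius covariance, proved** — `loewnerNirenberg_inversion_eq`: for `Ω` open, a pole
  `a ∉ Ω`, `r > 0` and `x ∈ Ω`, `u_{ι(Ω)}(ι x) · ((r/|x-a|)²)^{(n-2)/2} = u_Ω(x)` for the inversion
  `ι = ι_{a,r}` (the Kelvin correspondence `u ↦ K u` is an order-preserving involution between the
  solutions of `Ω` and of `ι(Ω)`, so it carries the supremum `u_Ω` to `u_{ι(Ω)}`; the
  connectedness and exterior-point hypotheses of `loewnerNirenberg_inversion` are not needed);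
  and `IsMaximalSolution.kelvinTransform`: the Kelvin transform of a maximal solution of `Ω` is
  the maximal solution of `ι(Ω)` — F1 is Möbius invariant (González–Li–Nguyen 2018, §4: "By
  performing an inversion about a sphere we may assume without loss of generality that `∂Ω` is
  compact").

## References

* M. d. M. González, Y. Y. Li, L. Nguyen, *Existence and uniqueness to a fully nonlinear version
  of the Loewner–Nirenberg problem*, Commun. Math. Stat. 6 (2018) 269–288, arXiv:1804.08851:
  §2.2, Lemma 3.1, Lemma 3.4 (proof), §4 and Def. 4.1. [GonzalezLiNguyen2018]
* J. A. J. Duncan, L. Nguyen, *The fully nonlinear Loewner–Nirenberg problem: Liouville theorems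
  and counterexamples to local boundary estimates*, arXiv:2507.16383 (2025), Cor. 1.4.
  [DuncanNguyen2025]
-/

noncomputable section

open Set Filter Metric Module TopologicalSpace Bornology
open scoped Laplacian Topology ContDiff RealInnerProductSpace

namespace Literature.Analysis.PDE

namespace LoewnerNirenberg

variable {E : Type*} [NormedAddCommGroup E] [InnerProductSpace ℝ E] [FiniteDimensional ℝ E]

/-! ### The half-space: `dist(·,∂H)^{-(n-2)/2}` is the maximal solution of `H` -/

section HalfSpace

variable {p ν x : E} {v : E → ℝ}

omit [FiniteDimensional ℝ E] in
/-- **Balls tangent from inside**: `B(x + (R - d)ν, R) ⊆ H(p,ν)` for `d = ⟪x - p, ν⟫`, `‖ν‖ = 1`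
(the centre is at height `R` above `∂H`). [folklore] -/
theorem ball_subset_halfSpace (hν : ‖ν‖ = 1) (p x : E) (R : ℝ) :
    ball (x + (R - ⟪x - p, ν⟫) • ν) R ⊆ halfSpace p ν := by
  intro y hy
  rw [mem_ball, dist_eq_norm] at hy
  have h1 := abs_real_inner_le_norm (y - (x + (R - ⟪x - p, ν⟫) • ν)) ν
  rw [hν, mul_one] at h1
  have hνν : ⟪ν, ν⟫ = 1 := by rw [real_inner_self_eq_norm_sq, hν, one_pow]
  have h2 : ⟪y - p, ν⟫ = ⟪y - (x + (R - ⟪x - p, ν⟫) • ν), ν⟫ + R := by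
    simp only [inner_sub_left, inner_add_left, real_inner_smul_left, hνν]
    ring
  show 0 < ⟪y - p, ν⟫
  rw [h2]
  linarith [neg_abs_le ⟪y - (x + (R - ⟪x - p, ν⟫) • ν), ν⟫]

omit [FiniteDimensional ℝ E] in
/-- The distance from `x` to the centre of the tangent ball of radius `R > d` is `R - d`.
[folklore] -/
theorem norm_sub_tangentCenter (hν : ‖ν‖ = 1) (p x : E) {R : ℝ} (hR : ⟪x - p, ν⟫ < R) :
    ‖x - (x + (R - ⟪x - p, ν⟫) • ν)‖ = R - ⟪x - p, ν⟫ := by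
  rw [sub_add_eq_sub_sub, sub_self, zero_sub, norm_neg, norm_smul, hν, mul_one, Real.norm_eq_abs,
    abs_of_pos (sub_pos.2 hR)]

/-- **Every solution on a half-space lies below the half-space profile** (`‖ν‖ = 1`, `n ≥ 3`):
for `x ∈ H` with `d = ⟪x-p,ν⟫ = dist(x,∂H)` and `R > d`, comparison on the tangent ball
`B(x + (R-d)ν, R) ⊆ H` (`IsSolution.le_ballProfile_of_ball_subset`) gives
`v(x) ≤ (2R/(d(2R-d)))^{(n-2)/2}`, and `R → ∞` gives `v(x) ≤ d^{-(n-2)/2}` (the device of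
Loewner–Nirenberg; González–Li–Nguyen 2018, proof of Lemma 3.4).
[cite: GonzalezLiNguyen2018, Lemma 3.4 (proof)] -/
theorem IsSolution.le_halfSpaceProfile (hn : 3 ≤ finrank ℝ E) (hν : ‖ν‖ = 1)
    (hv : IsSolution (halfSpace p ν) v) (hx : x ∈ halfSpace p ν) :
    v x ≤ halfSpaceProfile p ν x := by
  obtain ⟨k, hk⟩ : ∃ k : ℝ, ((finrank ℝ E : ℝ) - 2) / 2 = k := ⟨_, rfl⟩
  have hd0 : 0 < ⟪x - p, ν⟫ := hx
  -- comparison on the tangent balls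
  have hle : ∀ R : ℝ, ⟪x - p, ν⟫ < R →
      v x ≤ (2 * R / (⟪x - p, ν⟫ * (2 * R + -⟪x - p, ν⟫))) ^ k := fun R hR => by
    have hxB : x ∈ ball (x + (R - ⟪x - p, ν⟫) • ν) R := by
      rw [mem_ball, dist_eq_norm, norm_sub_tangentCenter hν p x hR]
      linarith
    have h := hv.le_ballProfile_of_ball_subset hn (isOpen_halfSpace p ν)
      (ball_subset_halfSpace hν p x R) hxB
    have hden : R ^ 2 - (R - ⟪x - p, ν⟫) ^ 2 = ⟪x - p, ν⟫ * (2 * R + -⟪x - p, ν⟫) := by ring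
    rwa [ballProfile, norm_sub_tangentCenter hν p x hR, hden, hk] at h
  -- the limit `R → ∞`
  have hval : halfSpaceProfile p ν x = ⟪x - p, ν⟫⁻¹ ^ k := by
    simp only [halfSpaceProfile, hk]
    rw [Real.rpow_neg hd0.le, Real.inv_rpow hd0.le]
  rw [hval]
  refine ge_of_tendsto (tendsto_barrier_atTop hd0 (-⟪x - p, ν⟫) k) ?_
  filter_upwards [eventually_gt_atTop ⟪x - p, ν⟫] with R hR using hle R hR

/-- **F1 for half-spaces, PROVED**: for `n ≥ 3` and `‖ν‖ = 1`, `⟪x-p,ν⟫^{-(n-2)/2}` is the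
maximal solution of `H(p,ν)`. [cite: GonzalezLiNguyen2018, Def. 4.1 (with Lemma 3.4)] -/
theorem isMaximalSolution_halfSpaceProfile (hn : 3 ≤ finrank ℝ E) (p : E) (hν : ‖ν‖ = 1) :
    IsMaximalSolution (halfSpace p ν) (halfSpaceProfile p ν) where
  toIsSolution := isSolution_halfSpaceProfile hn p hν
  le := fun _ hv _ hx => hv.le_halfSpaceProfile hn hν hx

/-- `exists_isMaximalSolution` for half-spaces: `H(p,ν)`, `‖ν‖ = 1`, `n ≥ 3`, carries a positive
maximal solution. [cite: GonzalezLiNguyen2018, Def. 4.1 (with Lemma 3.4)] -/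
theorem exists_isMaximalSolution_halfSpace (hn : 3 ≤ finrank ℝ E) (p : E) (hν : ‖ν‖ = 1) :
    ∃ u : E → ℝ, IsMaximalSolution (halfSpace p ν) u ∧ ∀ x ∈ halfSpace p ν, 0 < u x :=
  ⟨_, isMaximalSolution_halfSpaceProfile hn p hν, fun _ hx => halfSpaceProfile_pos hx⟩

/-- **LN4 (half-space), unconditional**: `u_{H(p,ν)}(x) = ⟪x-p,ν⟫^{-(n-2)/2}`
(`= dist(x,∂H)^{-(n-2)/2}`) on `H(p,ν)`, `‖ν‖ = 1`, `n ≥ 3` (the maximal solution; Duncan–Nguyen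
2025, Cor. 1.4 for the profile). [cite: DuncanNguyen2025, Cor. 1.4] -/
theorem loewnerNirenberg_halfSpace_eqOn (hn : 3 ≤ finrank ℝ E) (p : E) (hν : ‖ν‖ = 1) :
    EqOn (loewnerNirenberg (halfSpace p ν)) (halfSpaceProfile p ν) (halfSpace p ν) :=
  (isMaximalSolution_halfSpaceProfile hn p hν).eqOn_loewnerNirenberg

end HalfSpace

/-! ### LN2: Möbius (inversion) covariance of `u_Ω`, unconditionally -/

section Inversion

open EuclideanGeometry

variable {Ω : Set E} {a : E} {r : ℝ}

/-- **Solutions of `Ω₂` lie below the Kelvin transform of `u_{Ω₁}`, `ι(Ω₂) = Ω₁`** (`n ≥ 3`,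
`Ω₁`, `Ω₂` open, pole `a ∉ Ω₂`, `r > 0`): for a solution `v` on `Ω₂`, `K v` solves on `Ω₁`
(F4, `isSolution_kelvinTransform_holds`), so `K v ≤ u_{Ω₁}` there (Lemma 3.1,
`IsSolution.le_loewnerNirenberg_of_isOpen`), and `v = K(K v) ≤ K u_{Ω₁}` as `K` is an
order-preserving involution. [cite: GonzalezLiNguyen2018, §2.2 and Lemma 3.1] -/
theorem IsSolution.le_kelvinTransform_loewnerNirenberg (hn : 3 ≤ finrank ℝ E) {Ω₁ Ω₂ : Set E}
    (h₁ : IsOpen Ω₁) (h₂ : IsOpen Ω₂) (ha₂ : a ∉ Ω₂) (hr : 0 < r)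
    (himg : inversion a r '' Ω₂ = Ω₁) {v : E → ℝ} (hv : IsSolution Ω₂ v) {y : E} (hy : y ∈ Ω₂) :
    v y ≤ LoewnerNirenberg.kelvinTransform a r (loewnerNirenberg Ω₁) y := by
  have hya : y ≠ a := fun h => ha₂ (h ▸ hy)
  have hKv : IsSolution Ω₁ (LoewnerNirenberg.kelvinTransform a r v) :=
    himg ▸ isSolution_kelvinTransform_holds hn hr h₂ ha₂ hv
  have hmem : inversion a r y ∈ Ω₁ := himg ▸ mem_image_of_mem _ hy
  calc v y = LoewnerNirenberg.kelvinTransform a r (LoewnerNirenberg.kelvinTransform a r v) y :=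
        (kelvinTransform_kelvinTransform hr v hya).symm
    _ ≤ LoewnerNirenberg.kelvinTransform a r (loewnerNirenberg Ω₁) y :=
        kelvinTransform_mono (hKv.le_loewnerNirenberg_of_isOpen hn h₁ hmem)

/-- **LN2 — Möbius (inversion) covariance of `u_Ω`, with no hypothesis on `Ω` beyond openness**:
for `n ≥ 3`, `Ω` open, a pole `a ∉ Ω`, `r > 0` and `x ∈ Ω`,
`u_{ι(Ω)}(ι x) · ((r/|x-a|)²)^{(n-2)/2} = u_Ω(x)` for `ι = ι_{a,r}`, i.e.
`u_{φΩ} ∘ φ · |φ'|^{(n-2)/2} = u_Ω` for the Möbius map `φ = ι` (the unconditional form of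
`loewnerNirenberg_inversion`: `u_Ω ≤ K u_{ι(Ω)}` on `Ω` and `u_{ι(Ω)} ≤ K u_Ω` on `ι(Ω)` by
`IsSolution.le_kelvinTransform_loewnerNirenberg`, and the two conformal factors are reciprocal).
[cite: GonzalezLiNguyen2018, §2.2 and Def. 4.1 (LoewnerNirenberg1974)] -/
theorem loewnerNirenberg_inversion_eq (hn : 3 ≤ finrank ℝ E) (hΩ : IsOpen Ω) (ha : a ∉ Ω)
    (hr : 0 < r) {x : E} (hx : x ∈ Ω) :
    loewnerNirenberg (inversion a r '' Ω) (inversion a r x) *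
        ((r / dist x a) ^ 2) ^ (((finrank ℝ E : ℝ) - 2) / 2) = loewnerNirenberg Ω x := by
  set Ω' : Set E := inversion a r '' Ω with hΩ'
  have hΩ'o : IsOpen Ω' := isOpen_image_inversion hr hΩ ha
  have ha' : a ∉ Ω' := notMem_image_inversion hr ha
  have hback : inversion a r '' Ω' = Ω := image_inversion_image_inversion hr
  have hxa : x ≠ a := fun h => ha (h ▸ hx)
  have hx' : inversion a r x ∈ Ω' := mem_image_of_mem _ hx
  -- `u_Ω ≤ K u_Ω'` on `Ω` and `u_Ω' ≤ K u_Ω` on `Ω'`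
  have hA : loewnerNirenberg Ω x ≤ LoewnerNirenberg.kelvinTransform a r (loewnerNirenberg Ω') x :=
    loewnerNirenberg_le fun v hv =>
      hv.le_kelvinTransform_loewnerNirenberg hn hΩ'o hΩ ha hr hΩ'.symm hx
  have hB : loewnerNirenberg Ω' (inversion a r x) ≤
      LoewnerNirenberg.kelvinTransform a r (loewnerNirenberg Ω) (inversion a r x) :=
    loewnerNirenberg_le fun v hv =>
      hv.le_kelvinTransform_loewnerNirenberg hn hΩ hΩ'o ha' hr hback hx'
  -- unfold the Kelvin transforms; the conformal factors at `x` and `ι x` are reciprocal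
  set F : ℝ := ((r / dist x a) ^ 2) ^ (((finrank ℝ E : ℝ) - 2) / 2) with hF
  have hfac : 0 ≤ F := Real.rpow_nonneg (sq_nonneg _) _
  have hA' : loewnerNirenberg Ω x ≤ loewnerNirenberg Ω' (inversion a r x) * F := by
    rw [mul_comm]; exact hA
  have hB' : loewnerNirenberg Ω' (inversion a r x) ≤
      ((dist x a / r) ^ 2) ^ (((finrank ℝ E : ℝ) - 2) / 2) * loewnerNirenberg Ω x := by
    have h := hB
    simp only [kelvinTransform, inversion_inversion a hr.ne' x, inversion_factor_inversion hr hxa]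
      at h
    exact h
  have hone : ((dist x a / r) ^ 2) ^ (((finrank ℝ E : ℝ) - 2) / 2) * F = 1 := by
    rw [hF, ← Real.mul_rpow (sq_nonneg _) (sq_nonneg _)]
    have hd : dist x a ≠ 0 := (dist_pos.2 hxa).ne'
    have hr' : r ≠ 0 := hr.ne'
    have : (dist x a / r) ^ 2 * (r / dist x a) ^ 2 = 1 := by field_simp
    rw [this, Real.one_rpow]
  refine le_antisymm ?_ hA'
  calc loewnerNirenberg Ω' (inversion a r x) * F
      ≤ ((dist x a / r) ^ 2) ^ (((finrank ℝ E : ℝ) - 2) / 2) * loewnerNirenberg Ω x * F :=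
        mul_le_mul_of_nonneg_right hB' hfac
    _ = loewnerNirenberg Ω x * (((dist x a / r) ^ 2) ^ (((finrank ℝ E : ℝ) - 2) / 2) * F) := by
        ring
    _ = loewnerNirenberg Ω x := by rw [hone, mul_one]

/-- **The Kelvin transform of a maximal solution is the maximal solution of the inverted set**
(`n ≥ 3`, `Ω` open, `a ∉ Ω`, `r > 0`): F1 is Möbius invariant (González–Li–Nguyen 2018, §4: "By
performing an inversion about a sphere we may assume without loss of generality that `∂Ω` is
compact"). [cite: GonzalezLiNguyen2018, §4 and §2.2] -/
theorem IsMaximalSolution.kelvinTransform (hn : 3 ≤ finrank ℝ E) (hΩ : IsOpen Ω) (ha : a ∉ Ω)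
    (hr : 0 < r) {u : E → ℝ} (hu : IsMaximalSolution Ω u) :
    IsMaximalSolution (inversion a r '' Ω) (LoewnerNirenberg.kelvinTransform a r u) where
  toIsSolution := isSolution_kelvinTransform_holds hn hr hΩ ha hu.toIsSolution
  le := fun v hv y hy => by
    have ha' : a ∉ inversion a r '' Ω := notMem_image_inversion hr ha
    have hya : y ≠ a := fun h => ha' (h ▸ hy)
    have hKv : IsSolution Ω (LoewnerNirenberg.kelvinTransform a r v) :=
      image_inversion_image_inversion (Ω := Ω) hr ▸
        isSolution_kelvinTransform_holds hn hr (isOpen_image_inversion hr hΩ ha) ha' hv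
    have hmem : inversion a r y ∈ Ω := by
      rw [← image_inversion_image_inversion (Ω := Ω) (a := a) hr]
      exact mem_image_of_mem _ hy
    calc v y = LoewnerNirenberg.kelvinTransform a r (LoewnerNirenberg.kelvinTransform a r v) y :=
          (kelvinTransform_kelvinTransform hr v hya).symm
      _ ≤ LoewnerNirenberg.kelvinTransform a r u y := kelvinTransform_mono (hu.le hKv hmem)

/-- **`exists_isMaximalSolution` is Möbius invariant**: an open `Ω` avoiding the pole `a` carries
a positive maximal solution as soon as `ι_{a,r}(Ω)` does (`r > 0`, `n ≥ 3`).
[cite: GonzalezLiNguyen2018, §4 and §2.2] -/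
theorem exists_isMaximalSolution_of_image_inversion (hn : 3 ≤ finrank ℝ E) (hΩ : IsOpen Ω)
    (ha : a ∉ Ω) (hr : 0 < r)
    (h : ∃ u : E → ℝ, IsMaximalSolution (inversion a r '' Ω) u ∧
      ∀ y ∈ inversion a r '' Ω, 0 < u y) :
    ∃ u : E → ℝ, IsMaximalSolution Ω u ∧ ∀ x ∈ Ω, 0 < u x := by
  obtain ⟨u, hu, hpos⟩ := h
  have ha' : a ∉ inversion a r '' Ω := notMem_image_inversion hr ha
  have hK := hu.kelvinTransform hn (isOpen_image_inversion hr hΩ ha) ha' hr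
  rw [image_inversion_image_inversion hr] at hK
  refine ⟨_, hK, fun x hx => ?_⟩
  have hxa : x ≠ a := fun h => ha (h ▸ hx)
  have hfac : 0 < ((r / dist x a) ^ 2) ^ (((finrank ℝ E : ℝ) - 2) / 2) :=
    Real.rpow_pos_of_pos (pow_pos (div_pos hr (dist_pos.2 hxa)) 2) _
  exact mul_pos hfac (hpos _ (mem_image_of_mem _ hx))

end Inversion

end LoewnerNirenberg

end Literature.Analysis.PDE
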